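import Summits.BirchSwinnertonDyer.BirchSwinnertonDyer.Theorems.AdditiveKolyvaginRoadManinFrameResidueProperRTameTwistFullSymbols
import Summits.BirchSwinnertonDyer.BirchSwinnertonDyer.Theorems.AdditiveKolyvaginRoadManinFrameResidueProperRTameTwist
import Literature.NumberTheory.EllipticCurves.KrausOesterle1992.TorsionCongruenceCriterionHasseWeilProofs
import Literature.NumberTheory.EllipticCurves.NonEisensteinPrimeOfSurjective
import HarnessLib

/-!
# Route `AdditiveKolyvaginRoad`, crux `ManinFrameResidueProperR` (stmt-BirchSwinnertonDyer-20709), line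
# `birth`, stub TDS (`p ≥ 11`): the FULL tame-twist lever — Manin's `p`-part at EVERY lattice-optimal datum
# and the conclusion of `stub_twistDegreeStep` at EVERY AKR residue frame, GRANTED ONE Literature fact
# (Kato's integral zeta elements in Néron units, all tame characters) — `--supports`, helper

Cell `pub/bsd-wall`, seat `bsd-wall-manin-p1` g3. THEOREMS ONLY; the published input is the Literature fact
`Literature.NumberTheory.EllipticCurves.kato_neron_isIntegral_twistedSymbolSum_of_additive` (hypothesis `hK`).
Compared with `…RTameTwist` ((A²)) and `…RTameTwistPlus` ((A⁺)), the hypothesis on the multiplicative primes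
is GONE (`a_ℓ = ±1` at `ℓ ∥ N` is the tree theorem
`KrausOesterle1992.lFunction_apply_prime_eq_one_or_eq_neg_one_of_mult`; the symbol integrality for every `γ`
is `pint_im_cuspSymbolL` of `…RTameTwistFullSymbols`). MAIN RESULTS: `not_dvd_c_of_tameTwistL` (fact ∧ `Addv`
∧ `Irr` ∧ `p > 7` ∧ `p² ∣ N` ∧ `a_ℓ = ±1` ⟹ `p ∤ c` at every lattice-optimal datum);
`twistDegreeStep_of_tameTwistL` = the conclusion of the registered stub `stub_twistDegreeStep` for every
`(W, p, V, W♭, C)` of its signature, from `hK` and `hnf` alone (so TDS, and with it the `p ≥ 11` half of the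
crux, holds GRANTED the Kato–Kosters–Pannekoek reading); `exists_member_not_dvd_c_of_tameTwistL`,
`forall_latticeOptimal_not_dvd_c_of_tameTwistL`. HONEST STATUS: conditional on that ONE fact (a derived
reading of Kato (8.1.3)/9.7/6.6 + Kim–Nakamura 2.1/2.4 ⟸ Kosters–Pannekoek Thm 1; referee flag in its
docstring; XL to discharge); nothing is closed by this file.
-/

set_option autoImplicit false
set_option linter.dupNamespace false

noncomputable section

open scoped Classical MatrixGroups

open WeierstrassCurve NumberField Literature.NumberTheory.EllipticCurves
  Literature.NumberTheory.EllipticCurves.ModularForms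
  Literature.NumberTheory.EllipticCurves.Rank1Residual
  Literature.NumberTheory.DiophantineGeometry IsDedekindDomain Rat.HeightOneSpectrum
  Summit.BirchSwinnertonDyer.Rank1Residual Summit.BirchSwinnertonDyer.Rank1Residual.Additive
  CongruenceSubgroup Complex

namespace Summit.BirchSwinnertonDyer.BirchSwinnertonDyer.Theorems.ManinFrameResidueProperRTameTwist

section MainFull

variable {p : ℕ} [hp : Fact p.Prime]

/-- **Manin's `p`-part at a lattice-optimal datum, from the tame-twist lever.** Let `W/ℚ` be globally
minimal, additive at a prime `p > 7` with `E[p]` irreducible, `D` a LATTICE-OPTIMAL datum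
(`Λ_E = c Λ_f`) at a level `N` with `p² ∣ N`, with `a_ℓ(W) = ±1` for every `ℓ ∥ N` (multiplicative primes) — NO further hypothesis on `(N, a_ℓ)`. GRANTED the all-characters Kato–Kosters–Pannekoek fact: `p ∤ c`.
Proof: `im Λ_f = ℤ·Ω⁻_f/2` is generated by the `Im {∞, γ∞}_f`, all in `ℤ_(p)|Ω⁻(W)|`
(`pint_im_cuspSymbolL`), so `ord_p ϖ ≥ 0` for `ϖ |Ω⁻(W)| = Ω⁻_f`, while `ord_p ϖ = −ord_p c` at a
lattice-optimal datum. [cite: Kato2004Asterisque, (8.1.3) (p. 180), Thm. 9.7 (p. 189)]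
[cite: KimNakamura2020, Cor. 2.4] [cite: EdixhovenManin1991, §1] -/
theorem not_dvd_c_of_tameTwistL (hK : kato_neron_isIntegral_twistedSymbolSum_of_additive)
    (W : WeierstrassCurve ℚ) [W.IsElliptic] [W.IsGloballyMinimal] {N : ℕ} [NeZero N]
    (D : ModularParametrizationData W N)
    (hopt : ∀ z ∈ D.L.lattice, ∃ w ∈ periodLattice D.f, z = D.c * w) (hp7 : 7 < p)
    (hadd : Addv W p) (hirr : Irr W p) (hpN : p ^ 2 ∣ N)
    (ha : ∀ ℓ ∈ N.primeFactors, ¬ ℓ ^ 2 ∣ N → W.LFunction ℓ = 1 ∨ W.LFunction ℓ = -1) :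
    ¬ (p : ℤ) ∣ D.c := by
  have hpP : p.Prime := hp.out
  have hp2 : p ≠ 2 := by omega
  have hc0 : D.c ≠ 0 := D.maninConstant_ne_zero_holds
  -- the period scalar `ϖ = m/|c|`
  obtain ⟨mm, -, hmm⟩ :=
    SkinnerUrban2014.exists_dvd_two_mul_imaginaryPeriodRat_eq_of_latticeEq D hopt
  set ϖ : ℚ := (mm : ℚ) / |(D.c : ℚ)| with hϖdef
  have habs0 : |(D.c : ℝ)| ≠ 0 := abs_ne_zero.mpr (by exact_mod_cast hc0)
  have hϖ : (ϖ : ℝ) * W.imaginaryPeriodRat = minusPeriod D.f := by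
    rw [hϖdef]; push_cast
    rw [div_mul_eq_mul_div, hmm]
    field_simp
  have hΩf : 0 < minusPeriod D.f :=
    IsNewform0.minusPeriod_pos_holds D.isNewformOf.1 D.isNewformOf.coeffField_eq_bot
  have hΩ : 0 < W.imaginaryPeriodRat := W.imaginaryPeriodRat_pos
  -- `Ω⁻_f/2 = Im {∞, γ∞}_f` for some `γ`
  have hmem : minusPeriod D.f / 2 ∈ imagPeriods D.f := by
    rw [SkinnerUrban2014.imagPeriods_eq_zmultiples_of_minusPeriod_pos D.f hΩf]
    exact AddSubgroup.mem_zmultiples _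
  obtain ⟨z, hz, hzim⟩ := AddSubgroup.mem_map.mp hmem
  have hz' : z ∈ (periodLattice D.f : Set ℂ) := hz
  rw [coe_periodLattice_eq_range] at hz'
  obtain ⟨γ, hγ⟩ := hz'
  have hP := pint_im_cuspSymbolL hK hp7 hadd hirr D.f D.isNewformOf hpN ha hϖ γ
  rw [hγ] at hP
  have hzim' : z.im = minusPeriod D.f / 2 := hzim
  -- `Im z / Ω = ϖ/2`
  have hq : (((z.im : ℝ) : ℂ) / (W.imaginaryPeriodRat : ℂ)) = ((ϖ / 2 : ℚ) : ℂ) := by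
    rw [hzim', ← hϖ]
    have hΩ0 : (W.imaginaryPeriodRat : ℂ) ≠ 0 := by exact_mod_cast hΩ.ne'
    push_cast
    field_simp
  rw [hq] at hP
  have hval := padicValRat_nonneg_of_pint hP
  have hϖ2 : padicValRat p (ϖ / 2) = padicValRat p ϖ := by
    have hϖ0 : ϖ ≠ 0 := by
      rintro h; rw [h, Rat.cast_zero, zero_mul] at hϖ; exact hΩf.ne' hϖ.symm
    rw [padicValRat.div hϖ0 two_ne_zero, show (2 : ℚ) = ((2 : ℕ) : ℚ) by norm_num, padicValRat.of_nat,
      padicValNat.eq_zero_of_not_dvd (fun h ↦ hp2 ((Nat.prime_dvd_prime_iff_eq hpP Nat.prime_two).mp h))]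
    simp
  rw [hϖ2, ManinFrameResidueProperRUnitTwist.padicValRat_eq_neg_of_mul_imaginaryPeriodRat_eq hp2 D hopt hϖ]
    at hval
  exact not_dvd_of_padicValRat_intCast_le_zero hc0 (by linarith)

/-- **At an AKR residue frame: a member with a Manin-unit conductor-level datum** (the member statement of
line `birth`), GRANTED the fact and modularity, at EVERY frame — `p ≥ 11`, additive, `E[p]` irreducible
(`a_ℓ = ±1` at `ℓ ∥ N(W)` by Kraus–Oesterlé, tree theorem): the
`X₀(N)`-optimal member (`X12.exists_isIsogenous_optimal`, lattice-optimal datum) has `p ∤ c₀` by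
`not_dvd_c_of_tameTwistL` (`N(W₀) = N(W)`, `a_ℓ(W₀) = a_ℓ(W)`). [cite: EdixhovenManin1991, §4 (cases 1/2)] -/
theorem exists_member_not_dvd_c_of_tameTwistL (hK : kato_neron_isIntegral_twistedSymbolSum_of_additive)
    (hnf : exists_isNewformOf) (W : WeierstrassCurve ℚ) [W.IsElliptic] [W.IsGloballyMinimal]
    [NeZero (W.conductorNorm ℤ)] (hp11 : 11 ≤ p) (hadd : Addv W p) (hirr : Irr W p) :
    ∃ (W₀ : WeierstrassCurve ℚ) (_ : W₀.IsElliptic) (_ : W₀.IsGloballyMinimal)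
      (D₀ : ModularParametrizationData W₀ (W.conductorNorm ℤ)),
      IsIsogenous W W₀ ∧ ¬ (p : ℤ) ∣ D₀.c := by
  obtain ⟨W₀, hE₀, hM₀, hNe₀, D₀'', hiso, hN, hopt''⟩ := X12.exists_isIsogenous_optimal hnf W
  haveI := hE₀
  haveI := hM₀
  haveI := hNe₀
  obtain ⟨D₀', hopt'⟩ := X12.exists_optimalDatum_of_level_eq hN D₀'' hopt''
  have hiso₀ : IsIsogenous W₀ W := hiso.symm_of_charZero
  have hL : W₀.LFunction = W.LFunction := hiso₀.LFunction_eq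
  have hadd₀ : Addv W₀ p := (X2.addv_iff_of_isIsogenous (p := p) hiso).mp hadd
  have hirr₀ : Irr W₀ p := (X12.irr_iff_of_isIsogenous hiso p).mp hirr
  have hpN : p ^ 2 ∣ W.conductorNorm ℤ := sq_dvd_conductorNorm_of_not_good_of_not_mult hadd
  have ha : ∀ ℓ ∈ (W.conductorNorm ℤ).primeFactors, ¬ ℓ ^ 2 ∣ W.conductorNorm ℤ →
      W₀.LFunction ℓ = 1 ∨ W₀.LFunction ℓ = -1 := by
    intro ℓ hℓ hℓ2
    haveI : Fact ℓ.Prime := ⟨Nat.prime_of_mem_primeFactors hℓ⟩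
    rw [hL]
    rcases hasGoodReductionAtPrime_or_hasMultiplicativeReductionAtPrime_of_not_sq_dvd_conductorNorm (V := W) hℓ2
      with hg | hmul
    · exact absurd (Nat.dvd_of_mem_primeFactors hℓ) (not_dvd_conductorNorm_of_hasGoodReductionAtPrime W hg)
    · exact KrausOesterle1992.lFunction_apply_prime_eq_one_or_eq_neg_one_of_mult W ℓ hmul
  exact ⟨W₀, hE₀, hM₀, D₀', hiso, not_dvd_c_of_tameTwistL hK W₀ D₀' hopt' (by omega) hadd₀ hirr₀ hpN ha⟩

/-- **TDS AT EVERY FRAME, from the tame-twist lever, GRANTED the Kato–Kosters–Pannekoek fact.** At an AKR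
residue frame `(W, p)` — `p ≥ 11`, additive, `E[p]` irreducible, newform granted (`hnf`) — and GRANTED the all-characters
Kato–Kosters–Pannekoek fact: for every unstarred (G)-ordinary globally minimal member `V ∼ W` and every
globally minimal model `W♭` of `V ⊗ χ_{p*}`, SOME conductor-level datum of `V` has strictly fewer factors
`p` in its modular degree than EVERY conductor-level datum of `W♭` — the CONCLUSION of the registered stub
`stub_twistDegreeStep` (Edixhoven 1991 §4, "case 2"), by the predecessor's
`twistDegreeStep_of_exists_member_not_dvd_c` (p540328). Neither the residue clause nor the degree
clause `hall` of the stub is used; K4 is not used. [cite: EdixhovenManin1991, §4 (cases 1/2)]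
[cite: Kato2004Asterisque, Thm. 9.7 (p. 189)] -/
theorem twistDegreeStep_of_tameTwistL (hK : kato_neron_isIntegral_twistedSymbolSum_of_additive)
    (hnf : exists_isNewformOf) (W : WeierstrassCurve ℚ) [W.IsElliptic] [W.IsGloballyMinimal]
    [NeZero (W.conductorNorm ℤ)] (hp11 : 11 ≤ p) (hadd : Addv W p) (hirr : Irr W p)
    (V : WeierstrassCurve ℚ) [V.IsElliptic] [V.IsGloballyMinimal] [NeZero (V.conductorNorm ℤ)]
    (Wf : WeierstrassCurve ℚ) [Wf.IsElliptic] [Wf.IsGloballyMinimal] [NeZero (Wf.conductorNorm ℤ)]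
    (C : VariableChange ℚ) (hisoV : IsIsogenous W V) (hG : TypeGOrd V p)
    (hV4 : padicValInt p V.minimalDiscriminantInt ≤ 4)
    (hC : C • V.quadraticTwist ((-1 : ℚ) ^ (p / 2) * p) = Wf) :
    ∃ D : ModularParametrizationData V (V.conductorNorm ℤ),
      ∀ Df : ModularParametrizationData Wf (Wf.conductorNorm ℤ),
        padicValNat p D.modularDegree < padicValNat p Df.modularDegree :=
  ManinFrameResidueProperTwistDegree.twistDegreeStep_of_exists_member_not_dvd_c hnf W (by omega) hadd
    hirr hisoV hG hV4 C hC (exists_member_not_dvd_c_of_tameTwistL hK hnf W hp11 hadd hirr)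

/-- **The per-curve certificate.** For `W/ℚ` globally minimal, additive at a prime `p > 7` with `E[p]`
irreducible: EVERY lattice-optimal datum at level `N(W)` of EVERY globally minimal
`W₀ ∼ W` has `p ∤ c₀` — GRANTED the fact; a congruence condition on `(N, a_ℓ)` alone (no `L`-value, no
modular degree, no period of `E`). [cite: Kato2004Asterisque, (8.1.3) (p. 180), Thm. 9.7 (p. 189)]
[cite: KimNakamura2020, Cor. 2.4] -/
theorem forall_latticeOptimal_not_dvd_c_of_tameTwistL
    (hK : kato_neron_isIntegral_twistedSymbolSum_of_additive)
    (W : WeierstrassCurve ℚ) [W.IsElliptic] [W.IsGloballyMinimal] [NeZero (W.conductorNorm ℤ)]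
    (hp7 : 7 < p) (hadd : Addv W p) (hirr : Irr W p)
    (W₀ : WeierstrassCurve ℚ) [W₀.IsElliptic] [W₀.IsGloballyMinimal] (hiso : IsIsogenous W W₀)
    (D₀ : ModularParametrizationData W₀ (W.conductorNorm ℤ))
    (hopt : ∀ z ∈ D₀.L.lattice, ∃ w ∈ periodLattice D₀.f, z = D₀.c * w) :
    ¬ (p : ℤ) ∣ D₀.c := by
  have hiso₀ : IsIsogenous W₀ W := hiso.symm_of_charZero
  have hL : W₀.LFunction = W.LFunction := hiso₀.LFunction_eq
  have hadd₀ : Addv W₀ p := (X2.addv_iff_of_isIsogenous (p := p) hiso).mp hadd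
  have hirr₀ : Irr W₀ p := (X12.irr_iff_of_isIsogenous hiso p).mp hirr
  have hpN : p ^ 2 ∣ W.conductorNorm ℤ := sq_dvd_conductorNorm_of_not_good_of_not_mult hadd
  have ha : ∀ ℓ ∈ (W.conductorNorm ℤ).primeFactors, ¬ ℓ ^ 2 ∣ W.conductorNorm ℤ →
      W₀.LFunction ℓ = 1 ∨ W₀.LFunction ℓ = -1 := by
    intro ℓ hℓ hℓ2
    haveI : Fact ℓ.Prime := ⟨Nat.prime_of_mem_primeFactors hℓ⟩
    rw [hL]
    rcases hasGoodReductionAtPrime_or_hasMultiplicativeReductionAtPrime_of_not_sq_dvd_conductorNorm (V := W) hℓ2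
      with hg | hmul
    · exact absurd (Nat.dvd_of_mem_primeFactors hℓ) (not_dvd_conductorNorm_of_hasGoodReductionAtPrime W hg)
    · exact KrausOesterle1992.lFunction_apply_prime_eq_one_or_eq_neg_one_of_mult W ℓ hmul
  exact not_dvd_c_of_tameTwistL hK W₀ D₀ hopt hp7 hadd₀ hirr₀ hpN ha



/-- **The registered stub `stub_twistDegreeStep` of line `birth` (crux `ManinFrameResidueProperR`,
stmt-BirchSwinnertonDyer-20709), VERBATIM binder list, GRANTED the Kato–Kosters–Pannekoek fact `hK`.**
The residue hypothesis `hres` and the «`p ∣ deg φ` for every member» hypothesis `hall` of the stub are not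
needed: the tame-twist lever gives a member with a Manin-unit conductor-level datum at EVERY frame with
`p > 7` additive and `E[p]` irreducible. So the `p ≥ 11` half of the crux is reduced to the single named
Literature fact `kato_neron_isIntegral_twistedSymbolSum_of_additive` (not discharged here; XL). -/
theorem stub_twistDegreeStep_of_kato (hK : kato_neron_isIntegral_twistedSymbolSum_of_additive)
    (hnf : exists_isNewformOf)
    (W : WeierstrassCurve ℚ) [W.IsElliptic] [W.IsGloballyMinimal]
    [NeZero (W.conductorNorm ℤ)] (hp11 : 11 ≤ p) (hadd : Addv W p) (hirr : Irr W p)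
    (_hres : ((p < 11 ∨ ∃ (W' : WeierstrassCurve ℚ) (_ : W'.IsElliptic) (_ : W'.IsGloballyMinimal),
          IsIsogenous W W' ∧ TypeGOrd W' p ∧ padicValInt p W'.minimalDiscriminantInt ≤ 4) ∧
        (∃ (W' : WeierstrassCurve ℚ) (_ : W'.IsElliptic) (_ : W'.IsGloballyMinimal),
          IsIsogenous W W' ∧ ∀ (v : HeightOneSpectrum ℤ) (n : ℕ), natGenerator v = p →
            W'.kodairaSymbolAt v ≠ KodairaSymbol.Istar n)))
    (_hall : (∀ (W' : WeierstrassCurve ℚ) [W'.IsElliptic] [W'.IsGloballyMinimal]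
          (D' : ModularParametrizationData W' (W.conductorNorm ℤ)),
          IsIsogenous W W' → p ∣ D'.modularDegree))
    (V : WeierstrassCurve ℚ) [V.IsElliptic] [V.IsGloballyMinimal] [NeZero (V.conductorNorm ℤ)]
    (Wf : WeierstrassCurve ℚ) [Wf.IsElliptic] [Wf.IsGloballyMinimal] [NeZero (Wf.conductorNorm ℤ)]
    (C : VariableChange ℚ) (hisoV : IsIsogenous W V) (hG : TypeGOrd V p)
    (hV4 : padicValInt p V.minimalDiscriminantInt ≤ 4)
    (hC : C • V.quadraticTwist ((-1 : ℚ) ^ (p / 2) * p) = Wf) :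
    ∃ D : ModularParametrizationData V (V.conductorNorm ℤ),
      ∀ Df : ModularParametrizationData Wf (Wf.conductorNorm ℤ),
        padicValNat p D.modularDegree < padicValNat p Df.modularDegree :=
  twistDegreeStep_of_tameTwistL hK hnf W hp11 hadd hirr V Wf C hisoV hG hV4 hC

end MainFull


end Summit.BirchSwinnertonDyer.BirchSwinnertonDyer.Theorems.ManinFrameResidueProperRTameTwist

end
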